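import Summits.MatrixMultiplication.MatrixMultiplication.Theorems.FarEdgeDescentFoldCoupling
import Summits.MatrixMultiplication.MatrixMultiplication.Theorems.FarEdgeDescentTameProfile
import HarnessLib

/-!
# Route `FarEdgeDescent` — the SQUARE GERM: the fold at its fixed point, the corner `(0,1)` that IS `ω = 2`,
and the generic leaf as a curvature floor at the anchor (lens-2, gen 25; support module, def-free)

The cut of record `ω(ℂ) = 2 ⟺ FiniteSaturation ∧ AnchoredLogConvexity` (`FarEdgeDescentChord.node_iff`,
deciding theorem `Theses.FarEdgeDescent.closes`) is UNCHANGED.  Gens 21–24 read the failure `ω(ℂ) > 2` of the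
square–cube pencil `f(x) := ω(1,x,1)` at TWO sites — the near vertex `α` (atoms N2 corner / N3 tangential) and the
first far zero `β` (W2 transversal / W3 tangential) — and gen 24 showed that the FOLD
`(1+y)·f(2/(1+y)) ≤ 2·f(y)` (`FarEdgeDescentPencilRealisability.omega_pencil_admissible`; defect form
`FarEdgeDescentAlphaPrice.dualDefect_le_excess`) couples them.  The fold has exactly one fixed point, the SQUARE
`y = 1`, which is also the ANCHOR of the generic leaf (`AnchoredLogConvexity` compares `e(m)²` with
`e(1)·e(2m−1)`, `e(x) := f(x) − (x+1)`, `e(1) = ω − 2`).  This file reads both leaves at that third site.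
Write `p := ∂⁻f(1)`, `q := ∂⁺f(1)` (they exist: `f` is convex on `ℝ`, `FarEdgeDescentNearVertex`).

* §1 SLOPES AT THE SQUARE.  `ω − 2 ≤ p ≤ q ≤ 1`, sharper `ω − 2 ≤ p·(1 − α)` (chord to the near vertex), and
  every `g ∈ [p, q]` is a global support slope: `ω + g(x−1) ≤ f(x)` on `ℝ` (`support_at_square`).
* §2 ★ THE FOLD AT ITS FIXED POINT.  Transporting the support line through the fold gives, for every `K > 0`,
  `f(K) ≥ ω + (ω − g)/2·(K − 1)` (`fold_transport`; `g = p` is the far bound, `g = q` the near bound), whence the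
  SQUARE SLOPE LAW `2p + q ≤ ω ≤ p + 2q` (`two_mul_leftDeriv_add_rightDeriv_le_omega`,
  `omega_le_leftDeriv_add_two_mul_rightDeriv`) — it contains the cube sandwich `p ≤ ω/3 ≤ q` — and two product
  laws: the CONTACT LAW `2(ω−2) ≤ (ω − q)(1 − α)` (near bound read at the near vertex; compare gen 23's price
  `κ₀(1−α) ≤ ω−2`) and the SATURATION LAW `2(ω−2) ≤ (b−1)(p − (ω−2))` at every saturated far shape `b > 1`
  (far bound read at a roof; the special leaf `FiniteSaturation` read at the square: a roof at `k` forces the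
  near slope `p ≥ (ω−2)(k+1)/(k−1)`).
* §3 ★ RIGIDITY: `ω = 2 ⟺ q = 1 ⟺ p = 0` (`mm_iff_rightDeriv_eq_one`, `mm_iff_leftDeriv_eq_zero`).  So the summit
  is EXACTLY the maximal corner `(p,q) = (0,1)` at the square; under `ω > 2` the corner is strictly blunter on
  both sides, `0 < p ≤ ω/3 ≤ q < 1` (`square_blunt_of_not_mm`), or absent: `f` differentiable at `1` forces
  `f'(1) = ω/3` and `ω > 2` (`hasDerivAt_omega_div_three`, `square_trichotomy`).  Both blunt atoms are inhabited by 3D-lawful theorem-compatible worlds: a corner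
  `(1/2, 7/8)` by gen 24's `W_poly`, a smooth square by the one-dark-point DIAGONAL WORLD of the companion module
  `FarEdgeDescentDiagonalWorld` (which is also the simplest lawful world with `FiniteSaturation ∧ ω > 2`).
* The companion module `FarEdgeDescentSquareCurvature` reads the GENERIC leaf at the same site:
  `AnchoredLogConvexity` is identically a scale-free curvature floor at the square, which under `ω > 2` forbids
  every affine exit from the square.

All statements are over `omegaRect ℂ`, `omega ℂ`, `dualExponentAlpha ℂ`, `_root_.MatrixMultiplication` and the
route decls; no `def`s; imports only landed modules.  Nothing here proves `ω = 2`.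
[cite: LottiRomani1983, §2 (p. 174)] [cite: HuangPan1998, §2 eq. (2.5)–(2.8)] [cite: CoppersmithWinograd1990, §6]
-/

set_option linter.dupNamespace false

noncomputable section

namespace Summit.MatrixMultiplication.MatrixMultiplication.Theorems.FarEdgeDescentSquareGerm

open Literature.Computability.AlgebraicComplexity
open Summit.MatrixMultiplication.MatrixMultiplication.Theses.FarEdgeDescent
  (FiniteSaturation AnchoredLogConvexity)
open Summit.MatrixMultiplication.MatrixMultiplication.Theorems.FarEdgeDescentNearVertex
  (profile_convexOn_univ mem_interior_univ hasRightDerivAt hasLeftDerivAt rightDeriv_le_slope)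
open Summit.MatrixMultiplication.MatrixMultiplication.Theorems.FarEdgeDescentAlphaPrice (dualDefect_le_excess)
open Summit.MatrixMultiplication.MatrixMultiplication.Theorems.FarEdgeDescentChord (saturated_of_omega_eq_two)
open Summit.MatrixMultiplication.MatrixMultiplication.Theorems.FarEdgeDescentTameProfile (exists_nat_excess_lt)
open Filter Topology Set

/-! ## §0 `ω(ℂ) > 2` when the summit fails -/

/-- `ω(ℂ) > 2` when the summit fails (`omega_two_le` and `MatrixMultiplication_iff`). -/
theorem two_lt_omega_of_not_mm (hS : ¬ _root_.MatrixMultiplication) : 2 < omega ℂ := by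
  rw [_root_.MatrixMultiplication_iff] at hS
  exact lt_of_le_of_ne (omega_two_le ℂ) (Ne.symm hS)

/-! ## §1 The one-sided slopes `p = ∂⁻f(1)`, `q = ∂⁺f(1)` at the square -/

/-- `ω − 2 ≤ ∂⁻f(1)`: the chord from `(0, f(0)) = (0, 2)` to the square lies below the left tangent. -/
theorem omega_sub_two_le_leftDeriv :
    omega ℂ - 2 ≤ derivWithin (fun y : ℝ => omegaRect ℂ 1 y 1) (Iio 1) 1 := by
  have h := profile_convexOn_univ.slope_le_leftDeriv_of_mem_interior (x := 0) (y := 1)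
    (mem_univ _) (mem_interior_univ 1) zero_lt_one
  rw [slope_def_field, omegaRect_one_one_one, omegaRect_one_zero_one, sub_zero, div_one] at h
  exact h

/-- CHORD TO THE NEAR VERTEX: `ω − 2 ≤ ∂⁻f(1)·(1 − α)` (`f(α) = 2`; for `α = 1` both sides vanish). -/
theorem omega_sub_two_le_leftDeriv_mul :
    omega ℂ - 2 ≤ derivWithin (fun y : ℝ => omegaRect ℂ 1 y 1) (Iio 1) 1 * (1 - dualExponentAlpha ℂ) := by
  rcases (dualExponentAlpha_le_one ℂ).lt_or_eq with hα | hα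
  · have h := profile_convexOn_univ.slope_le_leftDeriv_of_mem_interior (x := dualExponentAlpha ℂ) (y := 1)
      (mem_univ _) (mem_interior_univ 1) hα
    rw [slope_def_field, omegaRect_one_one_one, omegaRect_dualExponentAlpha,
      div_le_iff₀ (sub_pos.2 hα)] at h
    linarith
  · have hω : omega ℂ = 2 := (dualExponentAlpha_eq_one_iff ℂ).1 hα
    rw [hω, hα]
    norm_num

/-- `0 ≤ ∂⁻f(1)`. -/
theorem leftDeriv_nonneg : 0 ≤ derivWithin (fun y : ℝ => omegaRect ℂ 1 y 1) (Iio 1) 1 := by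
  linarith [omega_sub_two_le_leftDeriv, omega_two_le ℂ]

/-- `∂⁻f(1) ≤ ∂⁺f(1)` (convexity). -/
theorem leftDeriv_le_rightDeriv :
    derivWithin (fun y : ℝ => omegaRect ℂ 1 y 1) (Iio 1) 1 ≤
      derivWithin (fun y : ℝ => omegaRect ℂ 1 y 1) (Ioi 1) 1 :=
  profile_convexOn_univ.leftDeriv_le_rightDeriv_of_mem_interior (mem_interior_univ 1)

/-- `∂⁺f(1) ≤ 1` (one padding step: `f(2) ≤ f(1) + 1`). -/
theorem rightDeriv_le_one : derivWithin (fun y : ℝ => omegaRect ℂ 1 y 1) (Ioi 1) 1 ≤ 1 := by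
  have h := rightDeriv_le_slope (b := 1) (y := 2) one_lt_two
  have hpad := omegaRect_one_mid_one_le_add ℂ (p := 2) (q := 1) one_le_two
  rw [slope_def_field, omegaRect_one_one_one, show (2 : ℝ) - 1 = 1 by norm_num, div_one] at h
  rw [omegaRect_one_one_one] at hpad
  linarith

/-- ★ Every `g ∈ [∂⁻f(1), ∂⁺f(1)]` is a GLOBAL support slope at the square: `ω + g·(x − 1) ≤ f(x)` on `ℝ`. -/
theorem support_at_square {g : ℝ} (hpg : derivWithin (fun y : ℝ => omegaRect ℂ 1 y 1) (Iio 1) 1 ≤ g)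
    (hgq : g ≤ derivWithin (fun y : ℝ => omegaRect ℂ 1 y 1) (Ioi 1) 1) (x : ℝ) :
    omega ℂ + g * (x - 1) ≤ omegaRect ℂ 1 x 1 := by
  rcases lt_trichotomy x 1 with hx | rfl | hx
  · have h := profile_convexOn_univ.slope_le_leftDeriv_of_mem_interior (x := x) (y := 1)
      (mem_univ _) (mem_interior_univ 1) hx
    rw [slope_def_field, omegaRect_one_one_one, div_le_iff₀ (sub_pos.2 hx)] at h
    have h' : derivWithin (fun y : ℝ => omegaRect ℂ 1 y 1) (Iio 1) 1 * (1 - x) ≤ g * (1 - x) :=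
      mul_le_mul_of_nonneg_right hpg (sub_pos.2 hx).le
    linarith
  · rw [omegaRect_one_one_one]
    simp
  · have h := rightDeriv_le_slope (b := 1) (y := x) hx
    rw [slope_def_field, omegaRect_one_one_one, le_div_iff₀ (sub_pos.2 hx)] at h
    have h' : g * (x - 1) ≤ derivWithin (fun y : ℝ => omegaRect ℂ 1 y 1) (Ioi 1) 1 * (x - 1) :=
      mul_le_mul_of_nonneg_right hgq (sub_pos.2 hx).le
    linarith

/-! ## §2 ★ The fold at its fixed point: transport, the square slope law, contact and saturation laws -/

/-- ★ **FOLD TRANSPORT AT THE SQUARE.**  A support line `ω + g(x−1) ≤ f(x)` on `(0,∞)` gives, through the fold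
`d(2/(K+1)) ≤ (2/(K+1))·e(K)`, the bound `f(K) ≥ ω + (ω − g)/2·(K − 1)` for EVERY `K > 0`. -/
theorem fold_transport {g : ℝ} (hsup : ∀ x : ℝ, 0 < x → omega ℂ + g * (x - 1) ≤ omegaRect ℂ 1 x 1)
    {K : ℝ} (hK : 0 < K) :
    omega ℂ + (omega ℂ - g) / 2 * (K - 1) ≤ omegaRect ℂ 1 K 1 := by
  have hK1 : 0 < K + 1 := by linarith
  have h1 := hsup (2 / (K + 1)) (by positivity)
  have h2 := dualDefect_le_excess hK
  have h3 : omega ℂ - 2 + g * (2 / (K + 1) - 1) ≤ 2 / (K + 1) * (omegaRect ℂ 1 K 1 - (K + 1)) := by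
    linarith
  have h4 := mul_le_mul_of_nonneg_left h3 (le_of_lt (by positivity : (0 : ℝ) < (K + 1) / 2))
  have hu : (K + 1) / 2 * (2 / (K + 1)) = 1 := by field_simp
  linear_combination h4 + (omegaRect ℂ 1 K 1 - (K + 1) - g) * hu

/-- FAR BOUND (`g = ∂⁻f(1)`): `f(K) ≥ ω + (ω − ∂⁻f(1))/2·(K − 1)` for every `K > 0` (informative for `K > 1`;
with `∂⁻f(1) ≤ ω/3` it contains the cube line `(K+2)ω/3`). -/
theorem far_bound {K : ℝ} (hK : 0 < K) :
    omega ℂ + (omega ℂ - derivWithin (fun y : ℝ => omegaRect ℂ 1 y 1) (Iio 1) 1) / 2 * (K - 1) ≤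
      omegaRect ℂ 1 K 1 :=
  fold_transport (fun x _ => support_at_square le_rfl leftDeriv_le_rightDeriv x) hK

/-- NEAR BOUND (`g = ∂⁺f(1)`): `f(K) ≥ ω − (ω − ∂⁺f(1))/2·(1 − K)` for every `K > 0` (informative for `K < 1`). -/
theorem near_bound {K : ℝ} (hK : 0 < K) :
    omega ℂ + (omega ℂ - derivWithin (fun y : ℝ => omegaRect ℂ 1 y 1) (Ioi 1) 1) / 2 * (K - 1) ≤
      omegaRect ℂ 1 K 1 :=
  fold_transport (fun x _ => support_at_square leftDeriv_le_rightDeriv le_rfl x) hK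

/-- ★ **SQUARE SLOPE LAW, right half**: `ω ≤ ∂⁻f(1) + 2·∂⁺f(1)` (the fold differentiated at its fixed point
from the right: every right secant slope at the square is `≥ (ω − ∂⁻f(1))/2`). -/
theorem omega_le_leftDeriv_add_two_mul_rightDeriv :
    omega ℂ ≤ derivWithin (fun y : ℝ => omegaRect ℂ 1 y 1) (Iio 1) 1 +
      2 * derivWithin (fun y : ℝ => omegaRect ℂ 1 y 1) (Ioi 1) 1 := by
  have ht := (hasDerivWithinAt_iff_tendsto_slope' self_notMem_Ioi).1 (hasRightDerivAt 1)
  have hq : (omega ℂ - derivWithin (fun y : ℝ => omegaRect ℂ 1 y 1) (Iio 1) 1) / 2 ≤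
      derivWithin (fun y : ℝ => omegaRect ℂ 1 y 1) (Ioi 1) 1 := by
    refine ge_of_tendsto ht ?_
    filter_upwards [self_mem_nhdsWithin] with y hy
    rw [mem_Ioi] at hy
    have h := far_bound (K := y) (by linarith)
    rw [slope_def_field, omegaRect_one_one_one, le_div_iff₀ (sub_pos.2 hy)]
    linarith
  linarith

/-- ★ **SQUARE SLOPE LAW, left half**: `2·∂⁻f(1) + ∂⁺f(1) ≤ ω` (the fold differentiated at its fixed point from
the left: every left secant slope at the square is `≤ (ω − ∂⁺f(1))/2`). -/
theorem two_mul_leftDeriv_add_rightDeriv_le_omega :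
    2 * derivWithin (fun y : ℝ => omegaRect ℂ 1 y 1) (Iio 1) 1 +
      derivWithin (fun y : ℝ => omegaRect ℂ 1 y 1) (Ioi 1) 1 ≤ omega ℂ := by
  have ht := (hasDerivWithinAt_iff_tendsto_slope' self_notMem_Iio).1 (hasLeftDerivAt 1)
  have hp : derivWithin (fun y : ℝ => omegaRect ℂ 1 y 1) (Iio 1) 1 ≤
      (omega ℂ - derivWithin (fun y : ℝ => omegaRect ℂ 1 y 1) (Ioi 1) 1) / 2 := by
    refine le_of_tendsto ht ?_
    filter_upwards [Ioo_mem_nhdsLT zero_lt_one] with y hy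
    have h := near_bound (K := y) hy.1
    rw [slope_def_field, omegaRect_one_one_one, div_le_iff_of_neg (by linarith [hy.2] : y - 1 < 0)]
    linarith
  linarith

/-- COROLLARY (cube sandwich, left): `∂⁻f(1) ≤ ω/3`. -/
theorem leftDeriv_le_omega_div_three :
    derivWithin (fun y : ℝ => omegaRect ℂ 1 y 1) (Iio 1) 1 ≤ omega ℂ / 3 := by
  linarith [two_mul_leftDeriv_add_rightDeriv_le_omega, leftDeriv_le_rightDeriv]

/-- COROLLARY (cube sandwich, right): `ω/3 ≤ ∂⁺f(1)`. -/
theorem omega_div_three_le_rightDeriv :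
    omega ℂ / 3 ≤ derivWithin (fun y : ℝ => omegaRect ℂ 1 y 1) (Ioi 1) 1 := by
  linarith [omega_le_leftDeriv_add_two_mul_rightDeriv, leftDeriv_le_rightDeriv]

/-- ★ **CONTACT LAW AT THE SQUARE**: `2(ω − 2) ≤ (ω − ∂⁺f(1))·(1 − α)` — the near bound read at the near vertex
`f(α) = 2` (for `α = 0` it is `q ≤ 1 ≤ 4 − ω`).  The far slope deficit at the square times the near gap pays
twice the excess. -/
theorem contact_law :
    2 * (omega ℂ - 2) ≤
      (omega ℂ - derivWithin (fun y : ℝ => omegaRect ℂ 1 y 1) (Ioi 1) 1) * (1 - dualExponentAlpha ℂ) := by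
  rcases (dualExponentAlpha_nonneg ℂ).eq_or_lt with hα | hα
  · rw [← hα]
    have h1 := rightDeriv_le_one
    have h3 := omega_le_three' (K := ℂ)
    linarith
  · have h := near_bound (K := dualExponentAlpha ℂ) hα
    rw [omegaRect_dualExponentAlpha] at h
    nlinarith [h]

/-- ★ **SATURATION LAW AT THE SQUARE**: a saturated far shape `f(b) = b + 1`, `b > 1`, forces
`2(ω − 2) ≤ (b − 1)·(∂⁻f(1) − (ω − 2))` — the far bound read at a roof.  With `∂⁻f(1) ≤ ω/3` it contains the
roof price `ω ≤ 3(b+1)/(b+2)` (`FarEdgeDescentSpectralEdge.omega_le_of_roof`). -/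
theorem saturation_law {b : ℝ} (hb : 1 < b) (hsat : omegaRect ℂ 1 b 1 = b + 1) :
    2 * (omega ℂ - 2) ≤ (b - 1) * (derivWithin (fun y : ℝ => omegaRect ℂ 1 y 1) (Iio 1) 1 - (omega ℂ - 2)) := by
  have h := far_bound (K := b) (by linarith)
  rw [hsat] at h
  nlinarith [h]

/-- The special leaf read at the square: `FiniteSaturation ⟹ ∃ k ≥ 2, 2(ω−2) ≤ (k−1)(∂⁻f(1) − (ω−2))`, i.e. a
roof at `k` forces the near slope `∂⁻f(1) ≥ (ω − 2)(k + 1)/(k − 1)`. -/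
theorem leftDeriv_of_finiteSaturation (hF : FiniteSaturation) :
    ∃ k : ℕ, 2 ≤ k ∧ 2 * (omega ℂ - 2) ≤
      ((k : ℝ) - 1) * (derivWithin (fun y : ℝ => omegaRect ℂ 1 y 1) (Iio 1) 1 - (omega ℂ - 2)) := by
  obtain ⟨k, hk, hsat⟩ := hF
  have hk1 : (1 : ℝ) < k := by
    have : (2 : ℝ) ≤ k := by exact_mod_cast hk
    linarith
  exact ⟨k, hk, saturation_law hk1 hsat⟩

/-! ## §3 ★ Rigidity: the summit is the maximal corner `(0, 1)` at the square -/

/-- `ω = 2 ⟹ ∂⁺f(1) = 1` (`f(x) = x + 1` on `[1, ∞)`, Huang–Pan). -/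
theorem rightDeriv_eq_one_of_mm (hS : _root_.MatrixMultiplication) :
    derivWithin (fun y : ℝ => omegaRect ℂ 1 y 1) (Ioi 1) 1 = 1 := by
  rw [_root_.MatrixMultiplication_iff] at hS
  have h1 : HasDerivWithinAt (fun y : ℝ => y + 1) 1 (Ioi (1 : ℝ)) 1 := by
    simpa using (hasDerivWithinAt_id (1 : ℝ) (Ioi 1)).add_const (1 : ℝ)
  have h2 : HasDerivWithinAt (fun y : ℝ => omegaRect ℂ 1 y 1) 1 (Ioi (1 : ℝ)) 1 := by
    refine h1.congr_of_eventuallyEq ?_ ?_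
    · filter_upwards [self_mem_nhdsWithin] with y hy
      exact saturated_of_omega_eq_two hS (le_of_lt hy)
    · show omegaRect ℂ 1 1 1 = 1 + 1
      rw [omegaRect_one_one_one, hS]
      norm_num
  exact h2.derivWithin (uniqueDiffWithinAt_Ioi 1)

/-- `ω = 2 ⟹ ∂⁻f(1) = 0` (`f = 2` on `[0, 1]`, Huang–Pan). -/
theorem leftDeriv_eq_zero_of_mm (hS : _root_.MatrixMultiplication) :
    derivWithin (fun y : ℝ => omegaRect ℂ 1 y 1) (Iio 1) 1 = 0 := by
  rw [_root_.MatrixMultiplication_iff] at hS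
  have h1 : HasDerivWithinAt (fun _ : ℝ => (2 : ℝ)) 0 (Iio (1 : ℝ)) 1 := hasDerivWithinAt_const _ _ _
  have h2 : HasDerivWithinAt (fun y : ℝ => omegaRect ℂ 1 y 1) 0 (Iio (1 : ℝ)) 1 := by
    refine h1.congr_of_eventuallyEq ?_ ?_
    · filter_upwards [Ioo_mem_nhdsLT zero_lt_one] with y hy
      have h := omegaRect_eq_sub_min_of_omega_eq_two ℂ hS (r := 1) (s := y) (t := 1) zero_le_one
        hy.1.le zero_le_one
      have hm : min (1 : ℝ) (min y 1) = y := by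
        rw [min_eq_left hy.2.le, min_eq_right hy.2.le]
      rw [hm] at h
      show omegaRect ℂ 1 y 1 = 2
      linarith
    · show omegaRect ℂ 1 1 1 = 2
      rw [omegaRect_one_one_one, hS]
  exact h2.derivWithin (uniqueDiffWithinAt_Iio 1)

/-- ★ `∂⁺f(1) = 1 ⟹ ω = 2`: slope `1` is then a global support slope, `e(x) ≥ ω − 2` on `(1,∞)`, against
`e(k) → 0` (the landed `LogRate`). -/
theorem mm_of_rightDeriv_eq_one (hq : derivWithin (fun y : ℝ => omegaRect ℂ 1 y 1) (Ioi 1) 1 = 1) :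
    _root_.MatrixMultiplication := by
  by_contra hS
  have hω := two_lt_omega_of_not_mm hS
  obtain ⟨k, -, -, hk⟩ := exists_nat_excess_lt (ε := omega ℂ - 2) (by linarith) 2
  have h := support_at_square (g := 1) (le_of_le_of_eq leftDeriv_le_rightDeriv hq) hq.ge (k : ℝ)
  linarith

/-- ★ `∂⁻f(1) = 0 ⟹ ω = 2`: by the square slope law `ω ≤ 0 + 2·∂⁺f(1) ≤ 2`. -/
theorem mm_of_leftDeriv_eq_zero (hp : derivWithin (fun y : ℝ => omegaRect ℂ 1 y 1) (Iio 1) 1 = 0) :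
    _root_.MatrixMultiplication := by
  rw [_root_.MatrixMultiplication_iff]
  have h := omega_le_leftDeriv_add_two_mul_rightDeriv
  rw [hp] at h
  linarith [rightDeriv_le_one, omega_two_le ℂ]

/-- ★ `ω = 2 ⟺ ∂⁺f(1) = 1` — the summit holds iff the profile LEAVES the square at full speed. -/
theorem mm_iff_rightDeriv_eq_one :
    _root_.MatrixMultiplication ↔ derivWithin (fun y : ℝ => omegaRect ℂ 1 y 1) (Ioi 1) 1 = 1 :=
  ⟨rightDeriv_eq_one_of_mm, mm_of_rightDeriv_eq_one⟩

/-- ★ `ω = 2 ⟺ ∂⁻f(1) = 0` — the summit holds iff the profile ARRIVES at the square flat. -/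
theorem mm_iff_leftDeriv_eq_zero :
    _root_.MatrixMultiplication ↔ derivWithin (fun y : ℝ => omegaRect ℂ 1 y 1) (Iio 1) 1 = 0 :=
  ⟨leftDeriv_eq_zero_of_mm, mm_of_leftDeriv_eq_zero⟩

/-- ★ `ω = 2 ⟺` the square is the MAXIMAL CORNER `(∂⁻f(1), ∂⁺f(1)) = (0, 1)`. -/
theorem mm_iff_square_corner :
    _root_.MatrixMultiplication ↔
      derivWithin (fun y : ℝ => omegaRect ℂ 1 y 1) (Iio 1) 1 = 0 ∧
        derivWithin (fun y : ℝ => omegaRect ℂ 1 y 1) (Ioi 1) 1 = 1 :=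
  ⟨fun h => ⟨leftDeriv_eq_zero_of_mm h, rightDeriv_eq_one_of_mm h⟩, fun h => mm_of_leftDeriv_eq_zero h.1⟩

/-- Under `ω > 2` the corner is STRICTLY BLUNTER on both sides: `0 < ∂⁻f(1) ≤ ω/3 ≤ ∂⁺f(1) < 1`. -/
theorem square_blunt_of_not_mm (hS : ¬ _root_.MatrixMultiplication) :
    0 < derivWithin (fun y : ℝ => omegaRect ℂ 1 y 1) (Iio 1) 1 ∧
      derivWithin (fun y : ℝ => omegaRect ℂ 1 y 1) (Iio 1) 1 ≤ omega ℂ / 3 ∧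
      omega ℂ / 3 ≤ derivWithin (fun y : ℝ => omegaRect ℂ 1 y 1) (Ioi 1) 1 ∧
      derivWithin (fun y : ℝ => omegaRect ℂ 1 y 1) (Ioi 1) 1 < 1 := by
  refine ⟨?_, leftDeriv_le_omega_div_three, omega_div_three_le_rightDeriv,
    lt_of_le_of_ne rightDeriv_le_one (fun h => hS (mm_of_rightDeriv_eq_one h))⟩
  linarith [omega_sub_two_le_leftDeriv, two_lt_omega_of_not_mm hS]

/-- `f` is differentiable at the square iff `∂⁻f(1) = ∂⁺f(1)`. -/
theorem differentiableAt_one_iff :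
    DifferentiableAt ℝ (fun y : ℝ => omegaRect ℂ 1 y 1) 1 ↔
      derivWithin (fun y : ℝ => omegaRect ℂ 1 y 1) (Iio 1) 1 =
        derivWithin (fun y : ℝ => omegaRect ℂ 1 y 1) (Ioi 1) 1 := by
  constructor
  · intro hd
    have h := hd.hasDerivAt
    rw [(h.hasDerivWithinAt (s := Iio 1)).derivWithin (uniqueDiffWithinAt_Iio 1),
      (h.hasDerivWithinAt (s := Ioi 1)).derivWithin (uniqueDiffWithinAt_Ioi 1)]
  · intro hpq
    have hl := hasLeftDerivAt (1 : ℝ)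
    rw [hpq] at hl
    have h : HasDerivAt (fun y : ℝ => omegaRect ℂ 1 y 1)
        (derivWithin (fun y : ℝ => omegaRect ℂ 1 y 1) (Ioi 1) 1) 1 := by
      rw [hasDerivAt_iff_tendsto_slope, ← nhdsLT_sup_nhdsGT]
      exact ((hasDerivWithinAt_iff_tendsto_slope' self_notMem_Iio).1 hl).sup
        ((hasDerivWithinAt_iff_tendsto_slope' self_notMem_Ioi).1 (hasRightDerivAt 1))
    exact h.differentiableAt

/-- ★ `ω = 2 ⟹ f` is NOT differentiable at the square (the corner `(0,1)`). -/
theorem not_differentiableAt_one_of_mm (hS : _root_.MatrixMultiplication) :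
    ¬ DifferentiableAt ℝ (fun y : ℝ => omegaRect ℂ 1 y 1) 1 := by
  intro hd
  have h := differentiableAt_one_iff.1 hd
  rw [leftDeriv_eq_zero_of_mm hS, rightDeriv_eq_one_of_mm hS] at h
  exact zero_ne_one h

/-- ★ If `f` is differentiable at the square, its derivative there is `ω/3`: the square slope law pinches
`3f'(1) ≤ ω ≤ 3f'(1)` — the cube line `(x+2)ω/3` is then TANGENT to `f` at the square. -/
theorem hasDerivAt_omega_div_three (hd : DifferentiableAt ℝ (fun y : ℝ => omegaRect ℂ 1 y 1) 1) :
    HasDerivAt (fun y : ℝ => omegaRect ℂ 1 y 1) (omega ℂ / 3) 1 := by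
  have h := hd.hasDerivAt
  have e1 := (h.hasDerivWithinAt (s := Iio 1)).derivWithin (uniqueDiffWithinAt_Iio 1)
  have e2 := (h.hasDerivWithinAt (s := Ioi 1)).derivWithin (uniqueDiffWithinAt_Ioi 1)
  have l1 := omega_le_leftDeriv_add_two_mul_rightDeriv
  have l2 := two_mul_leftDeriv_add_rightDeriv_le_omega
  rw [e1, e2] at l1 l2
  have e : deriv (fun y : ℝ => omegaRect ℂ 1 y 1) 1 = omega ℂ / 3 := by linarith
  rwa [e] at h

/-- ★ **SQUARE TRICHOTOMY.**  Exactly one of: (Q1) `ω = 2`, the maximal corner `(0,1)`; (Q2) `ω > 2` with a blunt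
CORNER `0 < ∂⁻f(1) < ∂⁺f(1) < 1`; (Q3) `ω > 2` with a SMOOTH square, `f'(1) = ω/3`.  (Q2 is inhabited by gen 24's
`W_poly`, slopes `(1/2, 7/8)`; Q3 by the diagonal world of `FarEdgeDescentDiagonalWorld`, slope `3/4`.) -/
theorem square_trichotomy :
    (_root_.MatrixMultiplication ∧
        derivWithin (fun y : ℝ => omegaRect ℂ 1 y 1) (Iio 1) 1 = 0 ∧
        derivWithin (fun y : ℝ => omegaRect ℂ 1 y 1) (Ioi 1) 1 = 1) ∨
    (¬ _root_.MatrixMultiplication ∧ ¬ DifferentiableAt ℝ (fun y : ℝ => omegaRect ℂ 1 y 1) 1 ∧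
        0 < derivWithin (fun y : ℝ => omegaRect ℂ 1 y 1) (Iio 1) 1 ∧
        derivWithin (fun y : ℝ => omegaRect ℂ 1 y 1) (Iio 1) 1 <
          derivWithin (fun y : ℝ => omegaRect ℂ 1 y 1) (Ioi 1) 1 ∧
        derivWithin (fun y : ℝ => omegaRect ℂ 1 y 1) (Ioi 1) 1 < 1) ∨
    (¬ _root_.MatrixMultiplication ∧ HasDerivAt (fun y : ℝ => omegaRect ℂ 1 y 1) (omega ℂ / 3) 1 ∧
        derivWithin (fun y : ℝ => omegaRect ℂ 1 y 1) (Iio 1) 1 = omega ℂ / 3 ∧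
        derivWithin (fun y : ℝ => omegaRect ℂ 1 y 1) (Ioi 1) 1 = omega ℂ / 3) := by
  by_cases hS : _root_.MatrixMultiplication
  · exact Or.inl ⟨hS, leftDeriv_eq_zero_of_mm hS, rightDeriv_eq_one_of_mm hS⟩
  · obtain ⟨hp, hp3, hq3, hq⟩ := square_blunt_of_not_mm hS
    by_cases hd : DifferentiableAt ℝ (fun y : ℝ => omegaRect ℂ 1 y 1) 1
    · have h := hasDerivAt_omega_div_three hd
      refine Or.inr (Or.inr ⟨hS, h, ?_, ?_⟩)
      · exact (h.hasDerivWithinAt (s := Iio 1)).derivWithin (uniqueDiffWithinAt_Iio 1)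
      · exact (h.hasDerivWithinAt (s := Ioi 1)).derivWithin (uniqueDiffWithinAt_Ioi 1)
    · refine Or.inr (Or.inl ⟨hS, hd, hp, ?_, hq⟩)
      exact lt_of_le_of_ne leftDeriv_le_rightDeriv (fun h => hd (differentiableAt_one_iff.2 h))

end Summit.MatrixMultiplication.MatrixMultiplication.Theorems.FarEdgeDescentSquareGerm
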